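import Summits.Ventures.PercRepro.SixFourResidueThreePlaneLineCore

/-!
# PercRepro — C-025 at `(6,4)`: the plane-line branch (γ) of the `t = 3` tail, part 1 — `X₂ ≤ 2·#(co-collinear planes)` (p2, gen 10)

The cap-free bound on `X₂(G) = #{Z ⊆ G : r(Z) ≤ 2, r(G ∖ Z) ≤ 3}` that the plane-line branch of `TwentyOnePrime` uses
instead of the profile form of Lemma X̄₂ (E21-1 (b)): call a plane `P` CO-COLLINEAR for `G` when its trace has rank `3` and
its complement `G ∖ P` has rank `≤ 2` (`ccPlanes`).  Every counted `Z` contains `G ∖ P` for some co-collinear `P`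
(`exists_ccPlane`: a plane through `G ∖ Z` when that set has rank `3`, otherwise through `(G ∖ Z) ∪ {x}` for a point
`x ∈ Z` off `cl(G ∖ Z)`), and for a fixed `P` the sets `Z ⊇ G ∖ P` of rank `≤ 2` lie in the line `cl(G ∖ P)`, whose
intersection with `P` is at most one point (two points would put the whole line, hence `G ∖ P ≠ ∅`, inside the flat `P`) —
so at most `2` of them per plane (`card_x2Fiber_le_two`, needing `|G ∖ P| ≥ 2`).  Hence
**`X₂ ≤ 2·#ccPlanes`** (`X2cnt_le_two_mul_card_ccPlanes`) whenever every plane trace has `≤ g − 2` points.  With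
`J_three_ge_sum_slack_sub` this reduces the branch to `slack(P) ≥ 12/5` on the co-collinear planes and `slack ≥ 0`
elsewhere (the margin table / the `g ≥ 101` margins), see `SixFourResidueThreePlaneLine.lean`.
-/

namespace PercRepro.SixFour

open Finset ThmH

variable {α : Type*} [DecidableEq α] {M : Matroid α} [M.Finite] {G : Finset α}

/-! ## The co-collinear planes and the fibres -/

/-- The CO-COLLINEAR planes of `G`: the planes whose trace on `G` has rank `3` and whose complement in `G` has rank
`≤ 2`. -/
noncomputable def ccPlanes (M : Matroid α) [M.Finite] (G : Finset α) : Finset (Finset α) :=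
  (planes M).filter (fun P : Finset α =>
    M.eRk ((P ∩ G : Finset α) : Set α) = 3 ∧ M.eRk ((G \ P : Finset α) : Set α) ≤ 2)

/-- Membership in `ccPlanes`. -/
theorem mem_ccPlanes {P : Finset α} :
    P ∈ ccPlanes M G ↔ P ∈ planes M ∧ M.eRk ((P ∩ G : Finset α) : Set α) = 3 ∧
      M.eRk ((G \ P : Finset α) : Set α) ≤ 2 := by
  unfold ccPlanes
  rw [Finset.mem_filter]

/-- The `X₂`-fibre over a plane `P`: the subsets `Z ⊆ G` of rank `≤ 2` containing `G ∖ P`. -/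
noncomputable def x2Fiber (M : Matroid α) [M.Finite] (G P : Finset α) : Finset (Finset α) :=
  G.powerset.filter (fun Z : Finset α => G \ P ⊆ Z ∧ M.eRk (Z : Set α) ≤ 2)

/-- Membership in `x2Fiber`. -/
theorem mem_x2Fiber {P Z : Finset α} :
    Z ∈ x2Fiber M G P ↔ Z ⊆ G ∧ G \ P ⊆ Z ∧ M.eRk (Z : Set α) ≤ 2 := by
  unfold x2Fiber
  rw [Finset.mem_filter, Finset.mem_powerset]

/-! ## Small rank facts -/

/-- A pair of distinct points of the ground set has rank exactly `2`. -/
theorem eRk_pair_eq_two_of_simple (hs : Simple M) {a b : α} (ha : a ∈ gr M) (hb : b ∈ gr M) (hab : a ≠ b) :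
    M.eRk (({a, b} : Finset α) : Set α) = 2 := by
  have haE : a ∈ M.E := by rw [← coe_gr M]; exact_mod_cast ha
  have hbE : b ∈ M.E := by rw [← coe_gr M]; exact_mod_cast hb
  have h := hs a haE b hbE hab
  rw [Finset.coe_pair]
  exact h

/-! ## The fibre bound -/

/-- **At most two sets per plane**: if `P` is a plane with `|G ∖ P| ≥ 2`, the subsets `Z ⊆ G` of rank `≤ 2`
containing `G ∖ P` number at most `2`. -/
theorem card_x2Fiber_le_two (hs : Simple M) (hG : G ⊆ gr M) {P : Finset α} (hP : P ∈ planes M)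
    (h2 : 2 ≤ (G \ P).card) : (x2Fiber M G P).card ≤ 2 := by
  set D := G \ P with hD
  have hDG : D ⊆ G := Finset.sdiff_subset
  have hDgr : D ⊆ gr M := hDG.trans hG
  have hDE : (D : Set α) ⊆ M.E := by rw [← coe_gr M]; exact_mod_cast hDgr
  have hD2 : (2 : ℕ∞) ≤ M.eRk (D : Set α) := two_le_eRk_of_two_le_card hs hG hDG h2
  obtain ⟨-, hPflat, -⟩ := mem_planes.1 hP
  by_cases hrD : M.eRk (D : Set α) ≤ 2
  · -- the line `cl(D)` meets `P` in at most one point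
    set W := clF M D ∩ P with hW
    have hW1 : W.card ≤ 1 := by
      by_contra hc
      push Not at hc
      obtain ⟨u, hu, v, hv, huv⟩ := Finset.one_lt_card.1 hc
      rw [hW, Finset.mem_inter] at hu hv
      have hu' : u ∈ M.closure (D : Set α) := by
        have := hu.1
        rw [← Finset.mem_coe, coe_clF] at this
        exact this
      have hv' : v ∈ M.closure (D : Set α) := by
        have := hv.1
        rw [← Finset.mem_coe, coe_clF] at this
        exact this
      have hugr : u ∈ gr M := by
        rw [← Finset.mem_coe, coe_gr]; exact M.closure_subset_ground _ hu'
      have hvgr : v ∈ gr M := by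
        rw [← Finset.mem_coe, coe_gr]; exact M.closure_subset_ground _ hv'
      have hpair : (({u, v} : Finset α) : Set α) ⊆ M.closure (D : Set α) := by
        rw [Finset.coe_pair]
        intro x hx
        simp only [Set.mem_insert_iff, Set.mem_singleton_iff] at hx
        rcases hx with rfl | rfl
        · exact hu'
        · exact hv'
      have hpairP : (({u, v} : Finset α) : Set α) ⊆ (P : Set α) := by
        rw [Finset.coe_pair]
        intro x hx
        simp only [Set.mem_insert_iff, Set.mem_singleton_iff] at hx
        rcases hx with rfl | rfl
        · exact_mod_cast hu.2
        · exact_mod_cast hv.2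
      -- `cl {u, v} = cl D`
      have hcl : M.closure (({u, v} : Finset α) : Set α) = M.closure (D : Set α) := by
        apply closure_eq_of_subset_flat (M.isFlat_closure _) hpair (Finset.finite_toSet _)
        rw [M.eRk_closure_eq, eRk_pair_eq_two_of_simple hs hugr hvgr huv]
        exact hrD
      -- hence `cl D ⊆ P` and `D ⊆ P`
      have hclP : M.closure (D : Set α) ⊆ (P : Set α) := by
        rw [← hcl, ← hPflat.closure]
        exact M.closure_subset_closure hpairP
      have hDP : (D : Set α) ⊆ (P : Set α) := (M.subset_closure _ hDE).trans hclP
      obtain ⟨a, ha, -, -, -⟩ := Finset.one_lt_card.1 (by omega : 1 < D.card)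
      have haP : a ∈ P := by exact_mod_cast hDP (Finset.mem_coe.2 ha)
      rw [hD, Finset.mem_sdiff] at ha
      exact ha.2 haP
    -- every `Z` of the fibre is `D ∪ Y` with `Y ⊆ W`
    have hsub : x2Fiber M G P ⊆ W.powerset.image (fun Y : Finset α => D ∪ Y) := by
      intro Z hZ
      rw [mem_x2Fiber] at hZ
      obtain ⟨hZG, hDZ, hZ2⟩ := hZ
      -- `Z ⊆ cl D`
      have hZE : (Z : Set α) ⊆ M.E := by rw [← coe_gr M]; exact_mod_cast hZG.trans hG
      have hDclZ : (D : Set α) ⊆ M.closure (Z : Set α) :=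
        (Finset.coe_subset.2 hDZ).trans (M.subset_closure _ hZE)
      have hcl : M.closure (D : Set α) = M.closure (Z : Set α) := by
        apply closure_eq_of_subset_flat (M.isFlat_closure _) hDclZ (Finset.finite_toSet _)
        rw [M.eRk_closure_eq]
        exact hZ2.trans hD2
      have hZcl : Z ⊆ clF M D := by
        intro x hx
        rw [← Finset.mem_coe, coe_clF, hcl]
        exact M.subset_closure _ hZE (Finset.mem_coe.2 hx)
      rw [Finset.mem_image]
      refine ⟨Z ∩ P, ?_, ?_⟩
      · rw [Finset.mem_powerset, hW]
        exact Finset.inter_subset_inter_right hZcl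
      · show D ∪ (Z ∩ P) = Z
        ext x
        rw [Finset.mem_union, Finset.mem_inter]
        constructor
        · rintro (hx | hx)
          · exact hDZ hx
          · exact hx.1
        · intro hx
          by_cases hxP : x ∈ P
          · exact Or.inr ⟨hx, hxP⟩
          · exact Or.inl (by rw [hD, Finset.mem_sdiff]; exact ⟨hZG hx, hxP⟩)
    calc (x2Fiber M G P).card ≤ (W.powerset.image (fun Y : Finset α => D ∪ Y)).card := Finset.card_le_card hsub
      _ ≤ W.powerset.card := Finset.card_image_le
      _ = 2 ^ W.card := Finset.card_powerset W
      _ ≤ 2 ^ 1 := Nat.pow_le_pow_right (by norm_num) hW1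
      _ = 2 := by norm_num
  · -- the fibre is empty
    have hempty : x2Fiber M G P = ∅ := by
      rw [Finset.eq_empty_iff_forall_notMem]
      intro Z hZ
      rw [mem_x2Fiber] at hZ
      exact hrD ((M.eRk_mono (Finset.coe_subset.2 hZ.2.1)).trans hZ.2.2)
    rw [hempty, Finset.card_empty]
    omega

/-! ## The covering -/

/-- **Every counted `Z` contains the complement of a co-collinear plane**: for `Z ⊆ G` with `r(Z) ≤ 2` and
`r(G ∖ Z) ≤ 3` there is `P ∈ ccPlanes` with `Z ∈ x2Fiber P`. -/
theorem exists_ccPlane (hs : Simple M) (hG : G ⊆ gr M) (hr : M.eRk (G : Set α) = 4) {Z : Finset α} (hZG : Z ⊆ G)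
    (hZ2 : M.eRk (Z : Set α) ≤ 2) (hZ3 : M.eRk ((G \ Z : Finset α) : Set α) ≤ 3) :
    ∃ P ∈ ccPlanes M G, Z ∈ x2Fiber M G P := by
  set D := G \ Z with hD
  have hDG : D ⊆ G := Finset.sdiff_subset
  have hDgr : D ⊆ gr M := hDG.trans hG
  have hDE : (D : Set α) ⊆ M.E := by rw [← coe_gr M]; exact_mod_cast hDgr
  have hZE : (Z : Set α) ⊆ M.E := by rw [← coe_gr M]; exact_mod_cast hZG.trans hG
  -- a plane through a rank-`3` subset `S ⊆ G` with `D ⊆ S` does the job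
  have key : ∀ S : Finset α, D ⊆ S → S ⊆ G → M.eRk (S : Set α) = 3 → ∃ P ∈ ccPlanes M G, Z ∈ x2Fiber M G P := by
    intro S hDS hSG hS3
    obtain ⟨P, hP, hSP⟩ := exists_plane_superset hG hr hSG hS3.le
    have hGP : G \ P ⊆ Z := by
      intro x hx
      rw [Finset.mem_sdiff] at hx
      by_contra hxZ
      have hxD : x ∈ D := by rw [hD, Finset.mem_sdiff]; exact ⟨hx.1, hxZ⟩
      exact hx.2 (hSP (hDS hxD))
    refine ⟨P, ?_, ?_⟩
    · rw [mem_ccPlanes]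
      refine ⟨hP, ?_, (M.eRk_mono (Finset.coe_subset.2 hGP)).trans hZ2⟩
      apply le_antisymm
      · rw [← (mem_planes.1 hP).2.2]
        exact M.eRk_mono (Finset.coe_subset.2 Finset.inter_subset_left)
      · rw [← hS3]
        exact M.eRk_mono (Finset.coe_subset.2 (Finset.subset_inter hSP hSG))
    · rw [mem_x2Fiber]
      exact ⟨hZG, hGP, hZ2⟩
  obtain ⟨k, hk, -⟩ := eRk_eq_nat M D
  have hk3 : k ≤ 3 := by rw [hk] at hZ3; exact_mod_cast hZ3
  by_cases hk3' : k = 3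
  · exact key D (le_refl D) hDG (by rw [hk]; exact_mod_cast hk3')
  · -- `r(D) ≤ 2`: pick `x ∈ Z` off `cl D`
    have hD2 : M.eRk (D : Set α) ≤ 2 := by
      rw [hk]; exact_mod_cast (by omega : k ≤ 2)
    have hGZD : (G : Set α) = (Z : Set α) ∪ (D : Set α) := by
      rw [hD, Finset.coe_sdiff, Set.union_sdiff_self, Set.union_eq_right.2 (Finset.coe_subset.2 hZG)]
    obtain ⟨x, hxZ, hxcl⟩ : ∃ x ∈ Z, x ∉ M.closure (D : Set α) := by
      by_contra hcon
      push Not at hcon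
      have hZcl : (Z : Set α) ⊆ M.closure (D : Set α) := fun x hx => hcon x (Finset.mem_coe.1 hx)
      have hGcl : (G : Set α) ⊆ M.closure (D : Set α) := by
        rw [hGZD]
        exact Set.union_subset hZcl (M.subset_closure _ hDE)
      have h4 : M.eRk (G : Set α) ≤ 2 := by
        calc M.eRk (G : Set α) ≤ M.eRk (M.closure (D : Set α)) := M.eRk_mono hGcl
          _ = M.eRk (D : Set α) := M.eRk_closure_eq _
          _ ≤ 2 := hD2
      rw [hr] at h4
      have h4' : (4 : ℕ) ≤ 2 := by exact_mod_cast h4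
      omega
    -- `D` has at least two points (else `r(G) ≤ r(Z) + 1 ≤ 3`)
    have hDcard : 2 ≤ D.card := by
      by_contra hc
      push Not at hc
      have hGr : M.eRk (G : Set α) ≤ 3 := by
        rcases Nat.lt_or_ge D.card 1 with h0 | h1
        · have hDe : D = ∅ := Finset.card_eq_zero.1 (by omega)
          have : (G : Set α) = (Z : Set α) := by rw [hGZD, hDe, Finset.coe_empty, Set.union_empty]
          rw [this]
          exact hZ2.trans (by exact_mod_cast (by norm_num : (2 : ℕ) ≤ 3))
        · obtain ⟨d, hd⟩ := Finset.card_eq_one.1 (by omega : D.card = 1)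
          have : (G : Set α) = insert d (Z : Set α) := by
            rw [hGZD, hd, Finset.coe_singleton, Set.union_singleton]
          rw [this]
          calc M.eRk (insert d (Z : Set α)) ≤ M.eRk (Z : Set α) + 1 := M.eRk_insert_le_add_one d _
            _ ≤ 2 + 1 := add_le_add_left hZ2 1
            _ = 3 := by rfl
      rw [hr] at hGr
      have h4' : (4 : ℕ) ≤ 3 := by exact_mod_cast hGr
      omega
    have hDr : M.eRk (D : Set α) = 2 :=
      le_antisymm hD2 (two_le_eRk_of_two_le_card hs hG hDG hDcard)
    have hxE : x ∈ M.E \ M.closure (D : Set α) := ⟨hZE (Finset.mem_coe.2 hxZ), hxcl⟩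
    have hS3 : M.eRk ((insert x D : Finset α) : Set α) = 3 := by
      rw [Finset.coe_insert, Matroid.eRk_insert_eq_add_one hxE, hDr]
      rfl
    exact key (insert x D) (Finset.subset_insert x D) (Finset.insert_subset (hZG hxZ) hDG) hS3

/-! ## The bound -/

/-- **`X₂ ≤ 2·#ccPlanes`** for every rank-`4` set `G ⊆ E` of a simple matroid all of whose plane traces have at most
`g − 2` points. -/
theorem X2cnt_le_two_mul_card_ccPlanes (hs : Simple M) (hG : G ⊆ gr M) (hr : M.eRk (G : Set α) = 4)
    (hpl : ∀ P ∈ planes M, (P ∩ G).card + 2 ≤ G.card) : X2cnt M G ≤ 2 * (ccPlanes M G).card := by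
  have hsub : G.powerset.filter (fun Z : Finset α =>
      M.eRk (Z : Set α) ≤ 2 ∧ M.eRk ((G \ Z : Finset α) : Set α) ≤ 3) ⊆
      (ccPlanes M G).biUnion (x2Fiber M G) := by
    intro Z hZ
    rw [Finset.mem_filter, Finset.mem_powerset] at hZ
    obtain ⟨P, hP, hZP⟩ := exists_ccPlane hs hG hr hZ.1 hZ.2.1 hZ.2.2
    exact Finset.mem_biUnion.2 ⟨P, hP, hZP⟩
  have hfib : ∀ P ∈ ccPlanes M G, (x2Fiber M G P).card ≤ 2 := by
    intro P hP
    have hP' := (mem_ccPlanes.1 hP).1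
    apply card_x2Fiber_le_two hs hG hP'
    have h1 := Finset.card_sdiff_add_card_inter G P
    have h2 := hpl P hP'
    rw [Finset.inter_comm] at h1
    omega
  calc X2cnt M G = (G.powerset.filter (fun Z : Finset α =>
        M.eRk (Z : Set α) ≤ 2 ∧ M.eRk ((G \ Z : Finset α) : Set α) ≤ 3)).card := rfl
    _ ≤ ((ccPlanes M G).biUnion (x2Fiber M G)).card := Finset.card_le_card hsub
    _ ≤ ∑ P ∈ ccPlanes M G, (x2Fiber M G P).card := Finset.card_biUnion_le
    _ ≤ ∑ P ∈ ccPlanes M G, 2 := Finset.sum_le_sum hfib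
    _ = 2 * (ccPlanes M G).card := by rw [Finset.sum_const, smul_eq_mul, mul_comm]

end PercRepro.SixFour
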